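import Summits.HodgeConjecture.HodgeConjecture.Theorems.Ring2TransportWeilTypeEveryCMFieldClosed
import Literature.AlgebraicGeometry.Deligne1982.WeilTypeCMHodgeRingHolds
import HarnessLib

/-!
# Ring 2 · transport seat (gen 25, file 2/2) — the union row T6 ∪ T6-CM with Deligne's endnote (fact #24) DISCHARGED: the binder `(h24 : Deligne1982_hodgeRing_weilTypeCM_of_hodgeGroupSU)` dropped, via the literature seat's PROOF `Deligne1982_hodgeRing_weilTypeCM_of_hodgeGroupSU_holds`

HONEST FRAMING (cell `pub-hodge-ring2`, verbatim): research route conditional on HC_CM; not a corollary;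
Q11.4-sentence-2 already refuted in dim ≥ 3.

Seat `transport`, HOME `run/shared/lean/pub/pub-hodge-ring2/`, map `RING2-MAP.md §transport (gen 25)`; helper file
supporting `stmt-HodgeConjecture-16267` (`Theses.RankFourFaces.CMToAbelian`), count once. `HC_CM` is the tree item
`Theses.RankFourFaces.CMAbelianHodge` (stmt-HodgeConjecture-3052), ALWAYS an explicit binder, never a cited fact. The
preprints [M] arXiv:2502.03415, [S] arXiv:2509.23403, [C] arXiv:2509.23079, [P] arXiv:2604.00511, [A] arXiv:2601.21052
are UNREFEREED (statements only, never inputs). Markman's Question 11.4 sentence 2 (the weak semiregularity criterion)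
is used nowhere below (refuted in dim ≥ 3: `HodgeTheory/SemiregularityWeakCriterionAbelianCounterexample`, `…Full`).
Companion file 1/2 (row T6-CM alone, `[E:ℚ] ≥ 4`): `Ring2TransportWeilTypeCMFieldDischarged.lean` (not imported here;
both files stand directly on the gen-5 closed forms).

WHAT AND WHY. The union class target T6 ∪ T6-CM `HodgeGeneralWeilTypeEveryCMField` (the Hodge conjecture for the
GENERAL abelian variety of Weil type relative to EVERY CM field `E = ℚ(η)`, `[E:ℚ] = 2e₀ ≥ 2`; gen 5,
`Ring2TransportWeilTypeEveryCMField.lean`) in its CLOSED form (gen 5 (ν), `Ring2TransportWeilTypeEveryCMFieldClosed.lean`: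
Moonen–Zarhin's criterion `MoonenZarhin1998_weilClasses_hodgeCriterion_holds` and both descents of `W_E ⊗ ℂ` — van
Geemen 4.9 for `e₀ = 1`, `weilClassesField_le_span_isRationalClass` for `e₀ ≥ 2` — fed in as theorems) carried ONE
literature binder: fact #24 `(h24 : Deligne1982.Deligne1982_hodgeRing_weilTypeCM_of_hodgeGroupSU)` = Milne's endnote 16
to Deligne's *Hodge cycles on abelian varieties* (Hodge group `= SU(φ)` ⟹ the `ℚ`-algebra of Hodge cycles is generated
by divisor classes and Weil classes, for every CM field), recorded as a named `def … : Prop` because both print loci are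
UNREFEREED (Milne 2003 re-edition, endnote 16; Milne 2025, Ex. 1.17). The literature seat (gen 19) has now PROVED it on
the carriers: `Deligne1982.Deligne1982_hodgeRing_weilTypeCM_of_hodgeGroupSU_holds`
(`Literature/AlgebraicGeometry/Deligne1982/WeilTypeCMHodgeRingHolds.lean`, p214055; Weil 1977 / van Geemen 6.12 invariant
theory for `∏_τ SL(W_τ)`; sorry-free, axioms `propext`, `Classical.choice`, `Quot.sound`; its type IS the binder's type,
verbatim). This file feeds `_holds` for `h24` in every union-row theorem and records the binder-free forms (suffix
`_discharged`); every source declaration stays in the tree as typed, so each `_discharged` theorem is its gen-5 (ν)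
source with ONE hypothesis removed — never a re-worded claim.

CONSEQUENCE FOR THE INPUT LEDGER OF THE UNION ROW (honest, after this file). NO unformalised literature input is left
except, on the GERM row only, the refereed `BuchweitzFlenner2003_variationalHodge_ISemiregular` (Buchweitz–Flenner
2003 Thm. 5.1; binder `hBF`). What remains hypothetical is exactly OURS/OPEN: `HC_CM` (binder, NOMINAL — see the
divisor-generated twins), per rung one anchor-SUPPLY leaf (`CMPointedWeilFamiliesQuadratic` / `…CMField`, or the
divisor-generated variants) and one TRANSPORT leaf (R∞var / R3var `WeilVariationalHodgeQuadratic` / `…CMField` ⟸ the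
local germs `LocalWeilVHCAtCMQuadratic` / `LocalWeilVHCAtCMField` ⟸ the semiregular Chern lifts
`SemiregularChernLiftAtCMQuadratic C` / `…AtCMField C` + BF 2003) — or the rungs R∞ `WeilClassesImaginaryQuadratic` and
R3 `WeilClassesCMField` themselves. In particular (§1): **R∞ → R3 → (T6 ∪ T6-CM) now holds UNCONDITIONALLY in the
kernel** — the Hodge conjecture for the general Weil-type abelian variety over every CM field IS the algebraicity of the
rational Weil classes, with no named fact in between; and given R∞ the union target is EQUIVALENT to T6-CM.

BINDER-COUNT LEDGER (for the referee's FULL audit; "lit" = unformalised literature binders; "ours" = `HC_CM` + our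
open leaves / rungs, UNCHANGED; `C : ChernCharacterBetti` is a parameter, not counted):

| `_discharged` theorem (this file) | source theorem (gen 5 (ν)) | lit before → after | ours |
|---|---|---|---|
| §1 `hodgeConjectureFor_weilTypeCM_one_discharged` | `hodgeConjectureFor_weilTypeCM_one_closed` | 1 (#24) → 0 | R∞ + slice data |
| §1 `hodgeGeneralWeilTypeEveryCMField_iff_discharged` | `…_iff_closed` | 1 → 0 | R∞ |
| §1 `hodgeGeneralWeilTypeEveryCMField_of_ladder_discharged` | `…_of_ladder_closed` | 1 → 0 | R∞, R3 |
| §2 `HC_GeneralWeilTypeEveryCMField_of_HC_CM_discharged` · `…_local_discharged` · `…_of_semiregularChernLift_discharged` | `…_closed` | 1 → 0 · 1 → 0 · 2 (#24, BF) → 1 (BF) | HC_CM, Sup₂, Sup₃ + R∞var, R3var · Loc₂, Loc₃ · Lift₂, Lift₃ |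
| §2 `HC_GeneralWeilTypeEveryCMField_of_divisorGeneratedCMPointed_discharged` · `…_local_…` · `…_of_semiregularChernLift_…` | `…_closed` | 1 → 0 · 1 → 0 · 2 → 1 (BF) | SupDiv₂, SupDiv₃ + R∞var, R3var · Loc₂, Loc₃ · Lift₂, Lift₃ |
| §3 `hodgeGeneralWeilTypeEveryCMField_position_discharged` | `…_closed_position` | #24 removed from every conjunct | — |

Legend: Sup₂ / Sup₃ = `CMPointedWeilFamiliesQuadratic` / `…CMField`; SupDiv₂ / SupDiv₃ = `DivisorGeneratedCMPointed…`;
R∞var / R3var = `WeilVariationalHodgeQuadratic` / `…CMField`; Loc₂ / Loc₃ = `LocalWeilVHCAtCMQuadratic` /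
`LocalWeilVHCAtCMField`; Lift₂ / Lift₃ = `SemiregularChernLiftAtCMQuadratic C` / `…AtCMField C`; BF =
`BuchweitzFlenner2003_variationalHodge_ISemiregular`.

HONEST STATUS of the target in print (unchanged by this file; cell paper `sec-transport`, Remark `rem:T6-honest`): the
`e₀ ≥ 2` half T6-CM is OPEN for every CM field of degree `≥ 4` (Deligne 1982 §4–5; Moonen–Zarhin 1998 §1; André
arXiv:2601.21052 §4.4.4, preprint; Markman's arXiv:2509.23079 announces degree-4 cases, UNREFEREED); the `e₀ = 1` half
is row T6 (van Geemen 6.12 = Weil 1977; Schoen 1988/1998, Koike 2004, Markman JEMS 2023 for the refereed cases).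
Nothing here is summit progress: the target is a CASE of the summit (`hodgeGeneralWeilTypeEveryCMField_of_hodgeConjecture`,
gen 5), and every theorem below valued in the target or in `HodgeConjectureFor A.dim A.X` has an OPEN statement of ours
among its hypotheses.

References: P. Deligne (notes by J. S. Milne), *Hodge cycles on abelian varieties*, LNM 900 (1982), §4 (4.4), Prop. 4.4,
Thm. 4.8, §5; endnote 16 of the 2003 re-edition [Deligne1982HodgeCycles]; J. S. Milne, arXiv:2508.09972 (2025), §1.5
Ex. 1.17 (unrefereed notes) [Milne2025AbelianMotivesCharP]; A. Weil, *Abelian varieties and the Hodge ring*, Œuvres III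
[1977c] [Weil1977HodgeRing]; B. van Geemen, LNM 1594 (1994), 4.9, Thm. 6.11–6.12 [vanGeemen1994HodgeAV]; B. Moonen,
Yu. Zarhin, *Weil classes on abelian varieties*, Crelle 496 (1998), §1 [MoonenZarhin1998WeilClasses]; R.-O. Buchweitz,
H. Flenner, Compositio Math. 137 (2003), Thm. 5.1–5.2 [BuchweitzFlenner2003]; F. Charles, C. Schnell, *Notes on absolute
Hodge classes* (2014), Conj. 11.3.1, Prop. 11.3.11 [CharlesSchnell2014Notes]; B. B. Gordon, *A survey of the Hodge
conjecture for abelian varieties* (1997), Thm. 6.4, §3 [Gordon1997]; E. Markman, arXiv:2509.23403, §12 (preprint /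
ICM 2026 lecture, unrefereed, statements only) [Markman2025SurveySecant].
-/

set_option linter.dupNamespace false

noncomputable section

open CategoryTheory

namespace Summit.HodgeConjecture.HodgeConjecture.Ring2Transport

open Literature.AlgebraicGeometry Literature.AlgebraicGeometry.Motives
open Literature.AlgebraicGeometry.HodgeTheory
open Literature.AlgebraicGeometry.Deligne1982
open Literature.AlgebraicGeometry.VanGeemen1994 (pullbackOne hodgeClassSpan)
open Literature.AlgebraicTopology.SingularHomology
open Summit.HodgeConjecture.HodgeConjecture.Theses
open Summit.HodgeConjecture.HodgeConjecture.WeilTypeLadder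

/-! ### §1 The `e₀ = 1` slice, exactness of the split, and the ladder row R∞ → R3 → Every — NO literature binder -/

/-- **`e₀ = 1`, binder-free: R∞ + carrier data ⟹ `HC(A)`** (fact #24 `_holds`, Moonen–Zarhin fed in; the descent is
van Geemen 4.9, a theorem; `k = 1` is the unconditional `dim ≤ 3` case inside the source). Gen 5 (ν)'s
`hodgeConjectureFor_weilTypeCM_one_closed` without `h24`. [cite: vanGeemen1994HodgeAV, 4.9 and Thm. 6.12]
[cite: Deligne1982HodgeCycles, §4 (4.4)] -/
theorem hodgeConjectureFor_weilTypeCM_one_discharged (hRq : WeilClassesImaginaryQuadratic) {A : AbelianVariety ℂ}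
    {η : A ⟶ A} {R : Polynomial ℤ} {k : ℕ} {h : complexBetti A.X 2} (hW : IsWeilTypeCM A η R 1 k)
    (hpol : IsPolarizationClass A.dim A.X h)
    (hRos : ∀ x y : complexBetti A.X 1,
      polarizationPairingOne A.X h (A.dim - 1) (pullbackOne A η x) y =
        -polarizationPairingOne A.X h (A.dim - 1) x (pullbackOne A η y))
    (hSU : HasHodgeGroupSUCM A η (R.comp (Polynomial.X ^ 2)) h) : HodgeConjectureFor A.dim A.X :=
  hodgeConjectureFor_weilTypeCM_one_closed Deligne1982_hodgeRing_weilTypeCM_of_hodgeGroupSU_holds hRq hW hpol hRos hSU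

/-- **Exactness of the split, binder-free: `R∞ → (Every ↔ T6-CM)`.** Gen 5 (ν)'s
`hodgeGeneralWeilTypeEveryCMField_iff_closed` without `h24`. [cite: Deligne1982HodgeCycles, §4 (4.4)]
[cite: vanGeemen1994HodgeAV, Thm. 6.12] -/
theorem hodgeGeneralWeilTypeEveryCMField_iff_discharged (hRq : WeilClassesImaginaryQuadratic) :
    HodgeGeneralWeilTypeEveryCMField ↔ HodgeGeneralWeilTypeCMField :=
  hodgeGeneralWeilTypeEveryCMField_iff_closed Deligne1982_hodgeRing_weilTypeCM_of_hodgeGroupSU_holds hRq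

/-- **LADDER ROW, UNCONDITIONALLY in the kernel: `R∞ → R3 → Every`.** The Hodge conjecture for the general Weil-type
abelian variety over EVERY CM field follows from the algebraicity of the RATIONAL Weil classes — rung R∞
(`WeilClassesImaginaryQuadratic`) for `[E:ℚ] = 2`, rung R3 (`WeilClassesCMField`) for `[E:ℚ] ≥ 4` — with NO named
fact, NO families, NO `HC_CM`: fact #24, Moonen–Zarhin and both descents are theorems. Gen 5 (ν)'s
`hodgeGeneralWeilTypeEveryCMField_of_ladder_closed` without `h24`.
[cite: Deligne1982HodgeCycles, §4 (4.4), Prop. 4.4 and Milne 2003 re-edition endnote 16]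
[cite: MoonenZarhin1998WeilClasses, §1 (Lemma (1), Criterion)] [cite: vanGeemen1994HodgeAV, 4.9, Thm. 6.12] -/
theorem hodgeGeneralWeilTypeEveryCMField_of_ladder_discharged (hRq : WeilClassesImaginaryQuadratic)
    (hR3 : WeilClassesCMField) : HodgeGeneralWeilTypeEveryCMField :=
  hodgeGeneralWeilTypeEveryCMField_of_ladder_closed Deligne1982_hodgeRing_weilTypeCM_of_hodgeGroupSU_holds hRq hR3

/-! ### §2 The union row from `HC_CM` (global / local / germ transport leaves) and its `HC_CM`-free twins, binder-free -/

/-- **Union row, global leaves, FIVE binders all ours: `HC_CM → (CM-pointed, quadratic) → R∞var → (CM-pointed, CM field)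
→ R3var → HodgeGeneralWeilTypeEveryCMField`.** Gen 5 (ν)'s `HC_GeneralWeilTypeEveryCMField_of_HC_CM_closed` without
`h24`. [cite: Deligne1982HodgeCycles, §4 proof of Thm. 4.8, §5, endnote 16] [cite: CharlesSchnell2014Notes, Conj. 11.3.1] -/
theorem HC_GeneralWeilTypeEveryCMField_of_HC_CM_discharged (hCM : Theses.RankFourFaces.CMAbelianHodge)
    (hPq : CMPointedWeilFamiliesQuadratic) (hVq : WeilVariationalHodgeQuadratic)
    (hP : CMPointedWeilFamiliesCMField) (hV : WeilVariationalHodgeCMField) : HodgeGeneralWeilTypeEveryCMField :=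
  HC_GeneralWeilTypeEveryCMField_of_HC_CM_closed hCM hPq hVq hP hV Deligne1982_hodgeRing_weilTypeCM_of_hodgeGroupSU_holds

/-- **Union row, LOCAL germs at CM fibres, five binders all ours: `HC_CM → (CM-pointed, quadratic) →
LocalWeilVHCAtCMQuadratic → (CM-pointed, CM field) → LocalWeilVHCAtCMField → HodgeGeneralWeilTypeEveryCMField`.**
Gen 5 (ν)'s `…_of_HC_CM_local_closed` without `h24`. [cite: CharlesSchnell2014Notes, Prop. 11.3.11 (proof)]
[cite: BuchweitzFlenner2003, Thm. 5.1] [cite: Deligne1982HodgeCycles, §4 (4.4), endnote 16] -/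
theorem HC_GeneralWeilTypeEveryCMField_of_HC_CM_local_discharged (hCM : Theses.RankFourFaces.CMAbelianHodge)
    (hPq : CMPointedWeilFamiliesQuadratic) (hLq : LocalWeilVHCAtCMQuadratic)
    (hP : CMPointedWeilFamiliesCMField) (hL : LocalWeilVHCAtCMField) : HodgeGeneralWeilTypeEveryCMField :=
  HC_GeneralWeilTypeEveryCMField_of_HC_CM_local_closed hCM hPq hLq hP hL
    Deligne1982_hodgeRing_weilTypeCM_of_hodgeGroupSU_holds

/-- **Union row, semiregular CHERN LIFTS at CM fibres + Buchweitz–Flenner: `HC_CM → (CM-pointed ×2) →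
SemiregularChernLiftAtCMQuadratic C → SemiregularChernLiftAtCMField C → BF2003 → HodgeGeneralWeilTypeEveryCMField`**
— the only literature binder left is BF 2003 Thm. 5.1 (REFEREED, unformalised). Gen 5 (ν)'s
`…_of_HC_CM_of_semiregularChernLift_closed` without `h24`. [cite: BuchweitzFlenner2003, §5 Thm. 5.1]
[cite: Deligne1982HodgeCycles, §4 (4.4), endnote 16] -/
theorem HC_GeneralWeilTypeEveryCMField_of_HC_CM_of_semiregularChernLift_discharged (C : ChernCharacterBetti)
    (hCM : Theses.RankFourFaces.CMAbelianHodge) (hPq : CMPointedWeilFamiliesQuadratic)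
    (hLq : SemiregularChernLiftAtCMQuadratic C) (hP : CMPointedWeilFamiliesCMField) (hL : SemiregularChernLiftAtCMField C)
    (hBF : BuchweitzFlenner2003_variationalHodge_ISemiregular) : HodgeGeneralWeilTypeEveryCMField :=
  HC_GeneralWeilTypeEveryCMField_of_HC_CM_of_semiregularChernLift_closed C hCM hPq hLq hP hL hBF
    Deligne1982_hodgeRing_weilTypeCM_of_hodgeGroupSU_holds

/-- **Union row WITHOUT `HC_CM`, global leaves, no literature binder** (gen 2's divisor-generated CM anchors on both
rungs; `HC_CM` NOMINAL on the union row). Gen 5 (ν)'s `…_of_divisorGeneratedCMPointed_closed` without `h24`.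
[cite: vanGeemen1994HodgeAV, 2.4] [cite: Gordon1997, Thm. 6.4 and §3 Theorem] [cite: Deligne1982HodgeCycles, §5, endnote 16] -/
theorem HC_GeneralWeilTypeEveryCMField_of_divisorGeneratedCMPointed_discharged
    (hPq : DivisorGeneratedCMPointedWeilFamiliesQuadratic) (hVq : WeilVariationalHodgeQuadratic)
    (hP : DivisorGeneratedCMPointedWeilFamiliesCMField) (hV : WeilVariationalHodgeCMField) :
    HodgeGeneralWeilTypeEveryCMField :=
  HC_GeneralWeilTypeEveryCMField_of_divisorGeneratedCMPointed_closed hPq hVq hP hV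
    Deligne1982_hodgeRing_weilTypeCM_of_hodgeGroupSU_holds

/-- **Union row WITHOUT `HC_CM`, LOCAL germs, no literature binder.** Gen 5 (ν)'s
`…_of_divisorGeneratedCMPointed_local_closed` without `h24`. [cite: Gordon1997, Thm. 6.4 and §3 Theorem]
[cite: CharlesSchnell2014Notes, Prop. 11.3.11 (proof)] [cite: Deligne1982HodgeCycles, §4 (4.4), endnote 16] -/
theorem HC_GeneralWeilTypeEveryCMField_of_divisorGeneratedCMPointed_local_discharged
    (hPq : DivisorGeneratedCMPointedWeilFamiliesQuadratic) (hLq : LocalWeilVHCAtCMQuadratic)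
    (hP : DivisorGeneratedCMPointedWeilFamiliesCMField) (hL : LocalWeilVHCAtCMField) :
    HodgeGeneralWeilTypeEveryCMField :=
  HC_GeneralWeilTypeEveryCMField_of_divisorGeneratedCMPointed_local_closed hPq hLq hP hL
    Deligne1982_hodgeRing_weilTypeCM_of_hodgeGroupSU_holds

/-- **Union row WITHOUT `HC_CM`, Chern lifts + Buchweitz–Flenner** (literature binder: BF 2003 only). Gen 5 (ν)'s
`…_of_divisorGeneratedCMPointed_of_semiregularChernLift_closed` without `h24`. [cite: Gordon1997, Thm. 6.4]
[cite: BuchweitzFlenner2003, §5 Thm. 5.1] [cite: Deligne1982HodgeCycles, §4 (4.4), endnote 16] -/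
theorem HC_GeneralWeilTypeEveryCMField_of_divisorGeneratedCMPointed_of_semiregularChernLift_discharged
    (C : ChernCharacterBetti) (hPq : DivisorGeneratedCMPointedWeilFamiliesQuadratic)
    (hLq : SemiregularChernLiftAtCMQuadratic C) (hP : DivisorGeneratedCMPointedWeilFamiliesCMField)
    (hL : SemiregularChernLiftAtCMField C) (hBF : BuchweitzFlenner2003_variationalHodge_ISemiregular) :
    HodgeGeneralWeilTypeEveryCMField :=
  HC_GeneralWeilTypeEveryCMField_of_divisorGeneratedCMPointed_of_semiregularChernLift_closed C hPq hLq hP hL hBF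
    Deligne1982_hodgeRing_weilTypeCM_of_hodgeGroupSU_holds

/-! ### §3 Position of the union node with no named fact left (kernel-checked conjunction) -/

/-- **Where the union node sits, with no named fact: `HC_AV ⟹ Every ⟹ T6-CM`; `Every ⟸ R∞ ∧ R3` with NOTHING else;
and under `HC_CM` with two supply and two transport leaves.** Gen 5 (ν)'s `hodgeGeneralWeilTypeEveryCMField_closed_position`
with `Deligne1982_hodgeRing_weilTypeCM_of_hodgeGroupSU` removed from every conjunct.
[cite: Deligne1982HodgeCycles, §4 (4.4), §5, endnote 16] [cite: MoonenZarhin1998WeilClasses, §1]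
[cite: vanGeemen1994HodgeAV, 4.9, Thm. 6.12] [cite: BuchweitzFlenner2003, §5 Thm. 5.1] -/
theorem hodgeGeneralWeilTypeEveryCMField_position_discharged (C : ChernCharacterBetti) :
    (PadicSemiregularLift.HodgeAbelianVarieties → HodgeGeneralWeilTypeEveryCMField) ∧
    (HodgeGeneralWeilTypeEveryCMField → HodgeGeneralWeilTypeCMField) ∧
    (WeilClassesImaginaryQuadratic → WeilClassesCMField → HodgeGeneralWeilTypeEveryCMField) ∧
    (Theses.RankFourFaces.CMAbelianHodge → CMPointedWeilFamiliesQuadratic → WeilVariationalHodgeQuadratic →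
      CMPointedWeilFamiliesCMField → WeilVariationalHodgeCMField → HodgeGeneralWeilTypeEveryCMField) ∧
    (Theses.RankFourFaces.CMAbelianHodge → CMPointedWeilFamiliesQuadratic → LocalWeilVHCAtCMQuadratic →
      CMPointedWeilFamiliesCMField → LocalWeilVHCAtCMField → HodgeGeneralWeilTypeEveryCMField) ∧
    (Theses.RankFourFaces.CMAbelianHodge → CMPointedWeilFamiliesQuadratic → SemiregularChernLiftAtCMQuadratic C →
      CMPointedWeilFamiliesCMField → SemiregularChernLiftAtCMField C → BuchweitzFlenner2003_variationalHodge_ISemiregular →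
      HodgeGeneralWeilTypeEveryCMField) ∧
    (DivisorGeneratedCMPointedWeilFamiliesQuadratic → LocalWeilVHCAtCMQuadratic →
      DivisorGeneratedCMPointedWeilFamiliesCMField → LocalWeilVHCAtCMField → HodgeGeneralWeilTypeEveryCMField) :=
  ⟨hodgeGeneralWeilTypeEveryCMField_of_hodgeAbelianVarieties, hodgeGeneralWeilTypeCMField_of_every,
    hodgeGeneralWeilTypeEveryCMField_of_ladder_discharged, HC_GeneralWeilTypeEveryCMField_of_HC_CM_discharged,
    HC_GeneralWeilTypeEveryCMField_of_HC_CM_local_discharged,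
    HC_GeneralWeilTypeEveryCMField_of_HC_CM_of_semiregularChernLift_discharged C,
    HC_GeneralWeilTypeEveryCMField_of_divisorGeneratedCMPointed_local_discharged⟩

/-! ## Audit: nothing is decided here — every theorem valued in the class target `HodgeGeneralWeilTypeEveryCMField` or
in `HodgeConjectureFor A.dim A.X` has among its hypotheses an OPEN statement of ours (a supply leaf and a transport
leaf per rung, the rungs R∞ / R3 themselves, or R∞ with the slice data), on the germ row the refereed unformalised
fact `BuchweitzFlenner2003_variationalHodge_ISemiregular`, and on the `HC_CM` rows `HC_CM` by name. Fact #24,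
Moonen–Zarhin's criterion and both descents are THEOREMS and appear as hypotheses nowhere in this file. Axiom
closures: the three standard axioms only. -/

#print axioms Summit.HodgeConjecture.HodgeConjecture.Ring2Transport.hodgeConjectureFor_weilTypeCM_one_discharged
#print axioms Summit.HodgeConjecture.HodgeConjecture.Ring2Transport.hodgeGeneralWeilTypeEveryCMField_of_ladder_discharged
#print axioms Summit.HodgeConjecture.HodgeConjecture.Ring2Transport.HC_GeneralWeilTypeEveryCMField_of_HC_CM_of_semiregularChernLift_discharged
#print axioms Summit.HodgeConjecture.HodgeConjecture.Ring2Transport.hodgeGeneralWeilTypeEveryCMField_position_discharged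

end Summit.HodgeConjecture.HodgeConjecture.Ring2Transport

end
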